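import Mathlib.Analysis.Normed.Affine.AddTorsor
import Mathlib.Analysis.Normed.Affine.AddTorsorBases
import Mathlib.LinearAlgebra.AffineSpace.FiniteDimensional
import Mathlib.Topology.Algebra.Affine
import Literature.Analysis.Convexity.SignArrangementTriangulation
import Literature.Topology.FourManifolds.PLManifoldProofs
import HarnessLib

/-!
# PL manifolds: composites of PL maps are PL (discharge of `IsPLOn.comp`)

This file proves the named fact `Literature.Topology.FourManifolds.IsPLOn.comp` of
`Literature.Topology.FourManifolds.PLManifold` — *if `f : ℝⁿ → ℝⁿ` is PL on the open set `u`
and `g` is PL on the open set `v`, then `g ∘ f` is PL on `u ∩ f ⁻¹' v`* — the standing hypothesis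
`hcomp` of the PL groupoid `plGroupoid n`, of `IsPLManifold`, `PLHomeomorph` and of the
Whitehead statements of that file (Rourke–Sanderson (1972), 2.14; Hudson (1969), Lemma 1.9):

* `IsPLOn.comp_holds : IsPLOn.comp`.

## Proof

The printed proofs take a common subdivision of the local complex for `f` and the pull-back of
the local complex for `g`, which needs the subdivision theory of convex cell complexes.  We use
instead the **chain triangulation of a sign arrangement**
(`Literature.Analysis.Convexity.SignArrangement.exists_simplicialComplex`).  Around a point
`a`, let `K ∋ a` and `L' ∋ f a` be finite complexes with `f = A s` affine on each closed simplex
`s` of `K` and `g = B t` affine on each closed simplex `t` of `L'`, and let `Δ = convexHull D` be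
a small simplex around `a` inside `K.space ∩ f ⁻¹' L'.space`
(`exists_affineIndependent_convexHull_subset`).  Consider the finite family of affine
functionals consisting of the barycentric coordinates of `D`, the barycentric coordinates of an
affine basis through each face `s` of `K`, and the barycentric coordinates of an affine basis
through each face `t` of `L'` composed with each `A s`.  Membership in a closed simplex is a sign
condition on barycentric coordinates (`mem_convexHull_image_affineBasis_iff`), so every closed
face of this arrangement inside `Δ` lies in a single simplex `s` of `K` and is mapped by `A s`
into a single simplex `t` of `L'`; hence `g ∘ f = B t ∘ A s` is affine on every simplex of the
chain triangulation of `Δ` (`exists_simplicialComplex_comp_affine`), which is the required finite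
complex around `a`.

## References

* C.P. Rourke, B.J. Sanderson, *Introduction to piecewise-linear topology*, Springer (1972),
  2.14. [RourkeSanderson1972]
* J.F.P. Hudson, *Piecewise linear topology*, Benjamin (1969), Lemma 1.9.
-/

open Set Function

noncomputable section

namespace Literature.Topology.FourManifolds

open _root_.Topology Literature.Analysis.Convexity Literature.Analysis.Convexity.SignArrangement

section HDescription

variable {E : Type*} [AddCommGroup E] [Module ℝ E]

/-- H-description of a sub-simplex of an affine basis: a point lies in the convex hull of the
basis points `β '' S` iff all its barycentric coordinates are nonnegative and those off `S`
vanish. [folklore] -/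
theorem mem_convexHull_image_affineBasis_iff {κ : Type*} [Finite κ] (β : AffineBasis κ ℝ E)
    (S : Set κ) (x : E) :
    x ∈ convexHull ℝ (β '' S) ↔ (∀ i, 0 ≤ β.coord i x) ∧ ∀ i, i ∉ S → β.coord i x = 0 := by
  classical
  cases nonempty_fintype κ
  constructor
  · intro hx
    have hconv : Convex ℝ {x : E | (∀ i, 0 ≤ β.coord i x) ∧ ∀ i, i ∉ S → β.coord i x = 0} := by
      intro x hx y hy a c ha hc hac
      refine ⟨fun i => ?_, fun i hi => ?_⟩
      · rw [Convex.combo_affine_apply hac]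
        simp only [smul_eq_mul]
        exact add_nonneg (mul_nonneg ha (hx.1 i)) (mul_nonneg hc (hy.1 i))
      · rw [Convex.combo_affine_apply hac, hx.2 i hi, hy.2 i hi, smul_zero, smul_zero, add_zero]
    refine convexHull_min ?_ hconv hx
    rintro _ ⟨j, hj, rfl⟩
    refine ⟨fun i => ?_, fun i hi => ?_⟩
    · rw [AffineBasis.coord_apply]
      split_ifs <;> norm_num
    · rw [AffineBasis.coord_apply_ne]
      rintro rfl
      exact hi hj
  · rintro ⟨h0, hS⟩
    have hvan : ∀ i ∈ (Finset.univ : Finset κ), i ∉ Finset.univ.filter (fun i => i ∈ S) →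
        β.coord i x • β i = 0 := fun i _ hi => by
      rw [hS i fun h => hi (Finset.mem_filter.2 ⟨Finset.mem_univ i, h⟩), zero_smul]
    have key : ∑ i ∈ Finset.univ.filter (fun i => i ∈ S), β.coord i x • β i ∈
        convexHull ℝ (β '' S) := by
      refine (convex_convexHull ℝ _).sum_mem (fun i _ => h0 i) ?_ fun i hi =>
        subset_convexHull ℝ _ ⟨i, (Finset.mem_filter.1 hi).2, rfl⟩
      rw [Finset.sum_subset (Finset.subset_univ _) fun i _ hi =>
        hS i fun h => hi (Finset.mem_filter.2 ⟨Finset.mem_univ i, h⟩)]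
      exact β.sum_coord_apply_eq_one x
    rwa [Finset.sum_subset (Finset.subset_univ _) hvan, β.linear_combination_coord_eq_self x] at key

/-- Sign transfer: if `x₀` lies in the sub-simplex `convexHull (β '' S)` of an affine basis and
every barycentric coordinate of `y` is either `0` or has the sign of the corresponding
coordinate of `x₀`, then `y` lies in the same sub-simplex. [folklore] -/
theorem mem_convexHull_image_affineBasis_of_sign {κ : Type*} [Finite κ] (β : AffineBasis κ ℝ E)
    (S : Set κ) {x₀ y : E} (hx₀ : x₀ ∈ convexHull ℝ (β '' S))
    (hy : ∀ i, SignType.sign (β.coord i y) = 0 ∨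
      SignType.sign (β.coord i y) = SignType.sign (β.coord i x₀)) :
    y ∈ convexHull ℝ (β '' S) := by
  rw [mem_convexHull_image_affineBasis_iff] at hx₀ ⊢
  refine ⟨fun i => ?_, fun i hi => ?_⟩
  · rcases hy i with h | h
    · exact (sign_eq_zero_iff.1 h).ge
    · rcases (hx₀.1 i).lt_or_eq with hpos | h0
      · rw [sign_pos hpos] at h
        exact (sign_eq_one_iff.1 h).le
      · rw [← h0, sign_zero] at h
        exact (sign_eq_zero_iff.1 h).ge
  · rcases hy i with h | h
    · exact sign_eq_zero_iff.1 h
    · rw [hx₀.2 i hi, sign_zero] at h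
      exact sign_eq_zero_iff.1 h

end HDescription

section Core

variable {E F V : Type*} [NormedAddCommGroup E] [NormedSpace ℝ E] [FiniteDimensional ℝ E]
  [AddCommGroup F] [Module ℝ F] [FiniteDimensional ℝ F] [AddCommGroup V] [Module ℝ V]

/-- **Composites of simplexwise affine maps are simplexwise affine on a chain triangulation.**
Let `f` agree with the affine map `A s` on each closed simplex `s` of a finite complex `K` in `E`,
let `g` agree with the affine map `B t` on each closed simplex `t` of a finite complex `L'` in
`F`, and let `D` be an affine basis of `E` (as a finset) whose simplex `Δ = convexHull D` lies in
`K.space` and is mapped by `f` into `L'.space`. Then there is a finite simplicial complex `P`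
with `P.space = Δ` on each of whose simplices `g ∘ f` agrees with an affine map.
(`P` is the chain triangulation `SignArrangement.exists_simplicialComplex` of the arrangement of
the barycentric-coordinate functionals of `D`, of affine bases through the faces of `K`, and of
affine bases through the faces of `L'` pulled back by the maps `A s`; membership in a simplex is
a sign condition on these functionals, so every closed face of the arrangement lies in one
simplex of `K` and is mapped by the corresponding `A s` into one simplex of `L'`.)
Rourke–Sanderson (1972), 2.14 (composition of PL maps), proved here without subdivision theory.
[folklore] -/
theorem exists_simplicialComplex_comp_affine
    {K : Geometry.SimplicialComplex ℝ E} (hKfin : K.faces.Finite) {f : E → F}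
    (A : Finset E → E →ᵃ[ℝ] F) (hA : ∀ s ∈ K.faces, EqOn f (A s) (convexHull ℝ (s : Set E)))
    {L' : Geometry.SimplicialComplex ℝ F} (hLfin : L'.faces.Finite) {g : F → V}
    (B : Finset F → F →ᵃ[ℝ] V) (hB : ∀ t ∈ L'.faces, EqOn g (B t) (convexHull ℝ (t : Set F)))
    {D : Finset E} (hDind : AffineIndependent ℝ ((↑) : D → E))
    (hDtot : affineSpan ℝ (D : Set E) = ⊤) (hDK : convexHull ℝ (D : Set E) ⊆ K.space)
    (hDL : MapsTo f (convexHull ℝ (D : Set E)) L'.space) :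
    ∃ P : Geometry.SimplicialComplex ℝ E, P.faces.Finite ∧ P.space = convexHull ℝ (D : Set E) ∧
      ∀ t ∈ P.faces, ∃ C : E →ᵃ[ℝ] V, EqOn (g ∘ f) C (convexHull ℝ (t : Set E)) := by
  classical
  -- the affine basis `δ` on `D`
  have hDrange : Set.range ((↑) : D → E) = (D : Set E) := Subtype.range_coe
  let δ : AffineBasis ↥D ℝ E := ⟨(↑), hDind, by rw [hDrange]; exact hDtot⟩
  -- affine bases through the faces of `K` and of `L'`
  have hT : ∀ s : ↥hKfin.toFinset, ∃ T : Set E, ((s : Finset E) : Set E) ⊆ T ∧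
      AffineIndependent ℝ ((↑) : T → E) ∧ affineSpan ℝ T = ⊤ := fun s =>
    exists_subset_affineIndependent_affineSpan_eq_top (K.indep (hKfin.mem_toFinset.1 s.2))
  choose T hTs hTind hTtot using hT
  have hT' : ∀ t : ↥hLfin.toFinset, ∃ T' : Set F, ((t : Finset F) : Set F) ⊆ T' ∧
      AffineIndependent ℝ ((↑) : T' → F) ∧ affineSpan ℝ T' = ⊤ := fun t =>
    exists_subset_affineIndependent_affineSpan_eq_top (L'.indep (hLfin.mem_toFinset.1 t.2))
  choose T' hT't hT'ind hT'tot using hT'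
  haveI hTfin : ∀ s, Finite (T s) := fun s =>
    (finite_set_of_fin_dim_affineIndependent ℝ (hTind s)).to_subtype
  haveI hT'fin : ∀ t, Finite (T' t) := fun t =>
    (finite_set_of_fin_dim_affineIndependent ℝ (hT'ind t)).to_subtype
  let β : ∀ s, AffineBasis ↥(T s) ℝ E := fun s =>
    ⟨(↑), hTind s, by rw [Subtype.range_coe]; exact hTtot s⟩
  let γ : ∀ t, AffineBasis ↥(T' t) ℝ F := fun t =>
    ⟨(↑), hT'ind t, by rw [Subtype.range_coe]; exact hT'tot t⟩
  -- the functionals of the arrangement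
  let ι : Type _ := ↥D ⊕ ((Σ s : ↥hKfin.toFinset, ↥(T s)) ⊕
    (Σ p : ↥hKfin.toFinset × ↥hLfin.toFinset, ↥(T' p.2)))
  haveI : Finite ι := by
    dsimp only [ι]
    infer_instance
  let Lf : ι → E →ᵃ[ℝ] ℝ := Sum.elim (fun i => δ.coord i)
    (Sum.elim (fun σ => (β σ.1).coord σ.2) fun σ => ((γ σ.1.2).coord σ.2).comp (A σ.1.1))
  haveI : Fintype ι := Fintype.ofFinite ι
  -- the admissible sign vectors (nonempty faces inside `Δ`) and chosen points
  let Φ : Finset (ι → SignType) := Finset.univ.filter fun ε =>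
    (face Lf ε).Nonempty ∧ ∀ i : ↥D, ε (Sum.inl i) = 0 ∨ ε (Sum.inl i) = 1
  let b : (ι → SignType) → E := fun ε => if h : (face Lf ε).Nonempty then h.some else 0
  have hb : ∀ ε ∈ Φ, b ε ∈ face Lf ε := fun ε hε => by
    have h := (Finset.mem_filter.1 hε).2.1
    simp only [b, dif_pos h]
    exact h.some_mem
  -- `Δ` and the closed faces of `Φ`
  have hΔ : convexHull ℝ (D : Set E) = {x | ∀ i : ↥D, 0 ≤ δ.coord i x} := by
    rw [← δ.convexHull_eq_nonneg_coord]
    congr 1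
    exact hDrange.symm
  have hcl_sub : ∀ ε ∈ Φ, cl Lf ε ⊆ convexHull ℝ (D : Set E) := fun ε hε y hy => by
    rw [hΔ]
    intro i
    have hεi := (Finset.mem_filter.1 hε).2.2 i
    have hyi : SignType.sign (δ.coord i y) = 0 ∨ SignType.sign (δ.coord i y) = ε (Sum.inl i) :=
      hy (Sum.inl i)
    rcases hyi with h | h
    · exact (sign_eq_zero_iff.1 h).ge
    · rcases hεi with h' | h'
      · rw [h'] at h
        exact (sign_eq_zero_iff.1 h).ge
      · rw [h'] at h
        exact (sign_eq_one_iff.1 h).le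
  have hdown : ∀ ε ∈ Φ, ∀ ε', SLE ε' ε → (face Lf ε').Nonempty → ε' ∈ Φ :=
    fun ε hε ε' hle hne => Finset.mem_filter.2 ⟨Finset.mem_univ _, hne, fun i => by
      rcases hle (Sum.inl i) with h | h
      · exact Or.inl h
      · rw [h]
        exact (Finset.mem_filter.1 hε).2.2 i⟩
  have hbdd : ∀ ε ∈ Φ, Bornology.IsBounded (cl Lf ε) := fun ε hε =>
    (D.finite_toSet.isCompact_convexHull ℝ).isBounded.subset (hcl_sub ε hε)
  obtain ⟨P, hPfin, hPface, hPcl⟩ := exists_simplicialComplex Lf Φ b hb hdown hbdd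
  -- the underlying space of `P` is `Δ`
  have hspace : P.space = convexHull ℝ (D : Set E) := by
    refine Subset.antisymm (fun x hx => ?_) (fun x hx => ?_)
    · obtain ⟨t, ht, hxt⟩ := Geometry.SimplicialComplex.mem_space_iff.1 hx
      obtain ⟨ε, hε, hsub⟩ := hPcl t ht
      exact hcl_sub ε hε (hsub hxt)
    · have hx' := hx
      rw [hΔ] at hx'
      have hεΦ : svec Lf x ∈ Φ := Finset.mem_filter.2 ⟨Finset.mem_univ _, ⟨x, rfl⟩, fun i => by
        rcases (hx' i).lt_or_eq with h | h
        · exact Or.inr (sign_pos h)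
        · refine Or.inl ?_
          show SignType.sign (δ.coord i x) = 0
          rw [← h, sign_zero]⟩
      exact hPface _ hεΦ (mem_face_svec x)
  refine ⟨P, hPfin, hspace, fun t ht => ?_⟩
  obtain ⟨ε, hε, htcl⟩ := hPcl t ht
  -- the chosen point `b ε` locates the simplex of `K` containing the closed face `ε`
  have hx₀ : b ε ∈ face Lf ε := hb ε hε
  have hx₀Δ : b ε ∈ convexHull ℝ (D : Set E) := hcl_sub ε hε (face_subset_cl hx₀)
  obtain ⟨s, hs, hx₀s⟩ := Geometry.SimplicialComplex.mem_space_iff.1 (hDK hx₀Δ)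
  let σ : ↥hKfin.toFinset := ⟨s, hKfin.mem_toFinset.2 hs⟩
  have himg : ((s : Finset E) : Set E) = (β σ) '' {j : ↥(T σ) | (j : E) ∈ s} := by
    ext x
    constructor
    · intro hx
      exact ⟨⟨x, hTs σ hx⟩, hx, rfl⟩
    · rintro ⟨j, hj, rfl⟩
      exact hj
  have hcl_s : cl Lf ε ⊆ convexHull ℝ (s : Set E) := fun y hy => by
    rw [himg] at hx₀s ⊢
    refine mem_convexHull_image_affineBasis_of_sign (β σ) _ hx₀s fun j => ?_
    have hεj : ε (Sum.inr (Sum.inl ⟨σ, j⟩)) = SignType.sign ((β σ).coord j (b ε)) :=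
      (congr_fun hx₀ (Sum.inr (Sum.inl ⟨σ, j⟩))).symm
    have := hy (Sum.inr (Sum.inl ⟨σ, j⟩))
    rw [hεj] at this
    exact this
  -- and `A s` maps the closed face into one simplex of `L'`
  have hz₀ : A s (b ε) ∈ L'.space := by
    rw [← hA s hs hx₀s]
    exact hDL hx₀Δ
  obtain ⟨t', ht', hz₀t⟩ := Geometry.SimplicialComplex.mem_space_iff.1 hz₀
  let τ : ↥hLfin.toFinset := ⟨t', hLfin.mem_toFinset.2 ht'⟩
  have himg' : ((t' : Finset F) : Set F) = (γ τ) '' {j : ↥(T' τ) | (j : F) ∈ t'} := by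
    ext z
    constructor
    · intro hz
      exact ⟨⟨z, hT't τ hz⟩, hz, rfl⟩
    · rintro ⟨j, hj, rfl⟩
      exact hj
  have hA_t : ∀ y ∈ cl Lf ε, A s y ∈ convexHull ℝ (t' : Set F) := fun y hy => by
    rw [himg'] at hz₀t ⊢
    refine mem_convexHull_image_affineBasis_of_sign (γ τ) _ hz₀t fun j => ?_
    have hεj : ε (Sum.inr (Sum.inr ⟨(σ, τ), j⟩)) =
        SignType.sign ((γ τ).coord j (A s (b ε))) :=
      (congr_fun hx₀ (Sum.inr (Sum.inr ⟨(σ, τ), j⟩))).symm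
    have := hy (Sum.inr (Sum.inr ⟨(σ, τ), j⟩))
    rw [hεj] at this
    exact this
  refine ⟨(B t').comp (A s), fun x hx => ?_⟩
  have hxcl : x ∈ cl Lf ε := htcl hx
  show g (f x) = B t' (A s x)
  rw [hA s hs (hcl_s hxcl), hB t' ht' (hA_t x hxcl)]

end Core


section SmallSimplex

variable {E : Type*} [NormedAddCommGroup E] [NormedSpace ℝ E] [FiniteDimensional ℝ E]

/-- Small simplices: every neighbourhood `N` of a point `a` of a finite-dimensional real normed
space contains a simplex — the convex hull of an affinely independent finset spanning the
space — which is itself a neighbourhood of `a` (shrink the simplex of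
`exists_affineIndependent_convexHull_mem_nhds` towards `a` by a homothety of small ratio).
[folklore] -/
theorem exists_affineIndependent_convexHull_subset {a : E} {N : Set E} (hN : N ∈ 𝓝 a) :
    ∃ D : Finset E, AffineIndependent ℝ ((↑) : D → E) ∧ affineSpan ℝ (D : Set E) = ⊤ ∧
      convexHull ℝ (D : Set E) ∈ 𝓝 a ∧ convexHull ℝ (D : Set E) ⊆ N := by
  classical
  obtain ⟨D₀, hD₀ind, hD₀nhds⟩ := exists_affineIndependent_convexHull_mem_nhds a
  obtain ⟨ε, hε, hball⟩ := Metric.mem_nhds_iff.1 hN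
  obtain ⟨R, hR, hDR⟩ := (D₀.finite_toSet.isCompact_convexHull ℝ).isBounded.subset_ball_lt 0 a
  set c : ℝ := min 1 (ε / (2 * R)) with hc
  have hc0 : 0 < c := lt_min one_pos (by positivity)
  have hcR : c * R < ε := by
    calc c * R ≤ ε / (2 * R) * R := by gcongr; exact min_le_right _ _
      _ = ε / 2 := by field_simp
      _ < ε := by linarith
  set e : E ≃ᵃ[ℝ] E := AffineEquiv.homothetyUnitsMulHom a (Units.mk0 c hc0.ne') with he
  have he_apply : ∀ x, e x = AffineMap.homothety a c x := fun x => by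
    simp [he, AffineEquiv.coe_homothetyUnitsMulHom_apply]
  have hconv : convexHull ℝ ((D₀.image e : Finset E) : Set E) =
      AffineMap.homothety a c '' convexHull ℝ (D₀ : Set E) := by
    rw [Finset.coe_image, ← image_convexHull_affineEquiv]
    exact Set.image_congr fun x _ => he_apply x
  have hnhds : convexHull ℝ ((D₀.image e : Finset E) : Set E) ∈ 𝓝 a := by
    rw [hconv]
    have h := (AffineMap.homothety_isOpenMap a c hc0.ne').image_mem_nhds hD₀nhds
    rwa [AffineMap.homothety_apply_same] at h
  refine ⟨D₀.image e, ?_, ?_, hnhds, ?_⟩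
  · have h := (e.affineIndependent_set_of_eq_iff (s := (D₀ : Set E))).2 hD₀ind
    rw [← Finset.coe_image] at h
    exact h
  · rw [← interior_convexHull_nonempty_iff_affineSpan_eq_top]
    exact ⟨a, mem_interior_iff_mem_nhds.2 hnhds⟩
  · rw [hconv]
    rintro _ ⟨y, hy, rfl⟩
    refine hball (Metric.mem_ball.2 ?_)
    have hya : dist a y < R := by
      rw [dist_comm]
      exact Metric.mem_ball.1 (hDR hy)
    calc dist (AffineMap.homothety a c y) a = ‖c‖ * dist a y := dist_homothety_center _ _ _
      _ = c * dist a y := by rw [Real.norm_of_nonneg hc0.le]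
      _ ≤ c * R := by gcongr
      _ < ε := hcR

end SmallSimplex

section Comp

variable {n : ℕ}

/-- **Discharge of `IsPLOn.comp`.** The composite of PL maps is PL on its natural domain: if
`f` is PL on the open set `u` and `g` is PL on the open set `v`, then `g ∘ f` is PL on
`u ∩ f ⁻¹' v`.  Around `a`, take finite complexes `K ∋ a` and `L' ∋ f a` on whose simplices `f`,
`g` are affine, a small simplex `Δ ∋ a` inside `K.space ∩ f ⁻¹' L'.space`
(`exists_affineIndependent_convexHull_subset`), and the chain triangulation of `Δ` adapted to
both (`exists_simplicialComplex_comp_affine`).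
Rourke–Sanderson (1972), 2.14; Hudson (1969), Lemma 1.9. [cite: RourkeSanderson1972] -/
theorem IsPLOn.comp_holds : IsPLOn.comp (n := n) := by
  intro f g u v hf hg hu _ _ a ha
  classical
  obtain ⟨K, hKfin, hKa, hKu, hK⟩ := hf a ha.1
  obtain ⟨L', hLfin, hLa, hLv, hL⟩ := hg (f a) ha.2
  choose! A hA using hK
  choose! B hB using hL
  have hfc : ContinuousAt f a := hf.continuousOn.continuousAt (hu.mem_nhds ha.1)
  have hN : K.space ∩ f ⁻¹' L'.space ∈ 𝓝 a := Filter.inter_mem hKa (hfc.preimage_mem_nhds hLa)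
  obtain ⟨D, hDind, hDtot, hDnhds, hDN⟩ := exists_affineIndependent_convexHull_subset hN
  obtain ⟨P, hPfin, hPspace, hP⟩ := exists_simplicialComplex_comp_affine hKfin A hA hLfin B hB
    hDind hDtot (fun x hx => (hDN hx).1) (fun x hx => (hDN hx).2)
  refine ⟨P, hPfin, ?_, ?_, fun t ht => hP t ht⟩
  · rw [hPspace]
    exact hDnhds
  · rw [hPspace]
    exact fun x hx => ⟨hKu (hDN hx).1, hLv (hDN hx).2⟩

end Comp

end Literature.Topology.FourManifolds
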